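import Summits.QuantumAdvantage.QuantumAdvantage.Theorems.CubicForrelationNearExactIsExactCubicFormR4ZPolar
import Summits.QuantumAdvantage.QuantumAdvantage.Theorems.CubicForrelationNearExactIsExactCubicFormR4Cells
import Summits.QuantumAdvantage.QuantumAdvantage.Theorems.CubicForrelationNearExactIsExactCubicFormR4CellForms
import Summits.QuantumAdvantage.QuantumAdvantage.Theorems.CubicForrelationNearExactIsExactCubicFormR4QfRadical

/-!
# Crux `CubicForrelation.NearExactIsExact` (stmt-QuantumAdvantage-14043) — E1280-even, R4 branch, descendant `0` (`HZ`), hyperplane case: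
  the DATA OF THE LEAF (the cubic form in the shape `d = ỹ∧ω + a∧(Ξ + Σ v_t∧M_t)`)

Certificate seat `b2b-cforr-cert` (gen 43).  HONEST FRAMING: kernel-checked bookkeeping (standard axioms).  In the adapted R4 frame with
`t̄₇ = 0`, suppose the forms of the cells satisfy `β_v = α(v)·Ξ` for a six-point-type affine `α = e ⊕ Σ vₜeₜ` (`e = e₀e₁ ⊕ e₂e₃`) and the
cells of `Z₁₀ ∩ {α = 0}` vanish identically (R4-PARTNER §4, `w = 3`, `z′ = 6`).  Then (`tq0_leaf_data`) the cubic form `d` of `κ` has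
`d(v_t, z_j, z_k) = a_t Ξ_{jk}` (`a` = linear part of `α`, nonzero) and `d(v_t, v_{t'}, z_j) = ω_{tt'} E_j + a_t M_{t'j} + a_{t'} M_{tj}`
(`ω = v₀v₁ + v₂v₃`): the first differences `v ↦ f_v(e_j) ⊕ f_v(0)` are quadratics vanishing on the six zero cells, so their quadratic parts lie
in `Π_Z = {ε·ω + a∧m}` (E1280-HANDPROOFS §2.4 (i); …CubicFormR4ZPolar).  These are exactly the hypotheses of the leaf statement consumed by
…CubicFormR4ZReduce.  Nothing about `θ₁₂`; NOT summit progress.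

References: this seat lineage (g39 HANDPROOFS §2.4 (i), g43 LEAN-GEN43).  Axioms: the standard three.
-/

set_option linter.dupNamespace false -- D-0017: single-problem summit ⇒ `QuantumAdvantage.QuantumAdvantage` by design

namespace Summit.QuantumAdvantage.QuantumAdvantage.Theorems.CubicForrelation.NearExactIsExact

open Finset
open Literature.Computability.QuantumComplexity
open Literature.Computability.QuantumComplexity.BuzetChailloux (bxor zeroVec bxor_comm bxor_self bxor_zeroVec zeroVec_bxor
  bxor_bxor_cancel_left)

/-- **The data of the leaf.**  See the module docstring. [this work] -/
theorem tq0_leaf_data (κ : (Fin (5 + 7) → Bool) → Bool) (hκ : IsDegLeFun 3 κ) (d : Fin (5 + 7) → Fin (5 + 7) → Fin (5 + 7) → ZMod 2)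
    (hd : ∀ φ j k, d φ j k =
      if ((((κ zeroVec ^^ κ (bxor zeroVec (fun l => decide (l = k)))) ^^ (κ (bxor zeroVec (fun l => decide (l = j))) ^^ κ (bxor (bxor zeroVec (fun l => decide (l = j))) (fun l => decide (l = k))))) ^^
          ((κ (bxor zeroVec (fun l => decide (l = φ))) ^^ κ (bxor (bxor zeroVec (fun l => decide (l = φ))) (fun l => decide (l = k)))) ^^ (κ (bxor (bxor zeroVec (fun l => decide (l = φ))) (fun l => decide (l = j))) ^^ κ (bxor (bxor (bxor zeroVec (fun l => decide (l = φ))) (fun l => decide (l = j))) (fun l => decide (l = k))))))) = true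
      then 1 else 0)
    (e e0 e1 e2 e3 : Bool) (h6 : e = ((e0 && e1) ^^ (e2 && e3))) (hA : (e0 || e1 || e2 || e3) = true)
    (Ξ : Fin 7 → Fin 7 → Bool)
    (hΞv : ∀ (v : Fin 4 → Bool) (j k : Fin 7), ((κ (Fin.append (Matrix.vecCons false v) zeroVec) ^^ κ (Fin.append (Matrix.vecCons false v) (fun l => decide (l = k)))) ^^ (κ (Fin.append (Matrix.vecCons false v) (fun l => decide (l = j))) ^^ κ (Fin.append (Matrix.vecCons false v) (bxor (fun l => decide (l = j)) (fun l => decide (l = k)))))) = (((((e ^^ (v 0 && e0)) ^^ (v 1 && e1)) ^^ (v 2 && e2)) ^^ (v 3 && e3)) && Ξ j k))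
    (v₀ : Fin 4 → Bool) (hv₀ : ((((e ^^ (v₀ 0 && e0)) ^^ (v₀ 1 && e1)) ^^ (v₀ 2 && e2)) ^^ (v₀ 3 && e3)) = true)
    (hzero : ∀ v : Fin 4 → Bool, ((v 0 && v 1) ^^ (v 2 && v 3)) = false → ((((e ^^ (v 0 && e0)) ^^ (v 1 && e1)) ^^ (v 2 && e2)) ^^ (v 3 && e3)) = false → ∀ s : Fin 7 → Bool, κ (Fin.append (Matrix.vecCons false v) s) = false) :
    ∃ (a : Fin 4 → ZMod 2) (Ξ' : Fin 7 → Fin 7 → ZMod 2) (E' : Fin 7 → ZMod 2) (M : Fin 4 → Fin 7 → ZMod 2),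
      (∃ t, a t = 1) ∧ (∀ j k, Ξ' k j = Ξ' j k) ∧ (∀ j, Ξ' j j = 0) ∧
      (∀ (t : Fin 4) (j k : Fin 7), d (Fin.castAdd 7 t.succ) (Fin.natAdd 5 j) (Fin.natAdd 5 k) = a t * Ξ' j k) ∧
      (∀ (t t' : Fin 4) (j : Fin 7), d (Fin.castAdd 7 t.succ) (Fin.castAdd 7 t'.succ) (Fin.natAdd 5 j) =
        ((if (t = 0 ∧ t' = 1) ∨ (t = 1 ∧ t' = 0) then (1 : ZMod 2) else 0) + (if (t = 2 ∧ t' = 3) ∨ (t = 3 ∧ t' = 2) then (1 : ZMod 2) else 0)) * E' j + a t * M t' j + a t' * M t j) := by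
  -- cells as translates of the base points `X_v = (0, v, 0)`
  have hcell : ∀ (v : Fin 4 → Bool) (s : Fin 7 → Bool), κ (Fin.append (Matrix.vecCons false v) s) =
      κ (bxor (Fin.append (Matrix.vecCons false v) (zeroVec : Fin 7 → Bool)) (Fin.append (zeroVec : Fin 5 → Bool) s)) := by
    intro v s; rw [tc5_append_bxor, bxor_zeroVec, zeroVec_bxor]
  have hXb : ∀ x t : Fin 4 → Bool, ((Fin.append (Matrix.vecCons false (bxor x t)) (zeroVec : Fin 7 → Bool)) : Fin (5 + 7) → Bool) = bxor (Fin.append (Matrix.vecCons false x) (zeroVec : Fin 7 → Bool)) (Fin.append (Matrix.vecCons false t) (zeroVec : Fin 7 → Bool)) := by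
    intro x t
    rw [tc5_append_bxor, bxor_zeroVec]
    congr 1
    funext l
    refine Fin.cases ?_ (fun i => ?_) l
    · rfl
    · rfl
  have hX0 : ((Fin.append (Matrix.vecCons false (zeroVec : Fin 4 → Bool)) (zeroVec : Fin 7 → Bool)) : Fin (5 + 7) → Bool) = zeroVec := by
    funext l
    refine Fin.addCases (fun i => ?_) (fun j => ?_) l
    · rw [Fin.append_left]
      refine Fin.cases rfl (fun i' => rfl) i
    · rw [Fin.append_right]; rfl
  have hXe : ∀ t : Fin 4, ((Fin.append (Matrix.vecCons false (fun l => decide (l = t))) (zeroVec : Fin 7 → Bool)) : Fin (5 + 7) → Bool) = fun l => decide (l = Fin.castAdd 7 t.succ) := by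
    intro t
    rw [tc5_unit_left]
    congr 1
    funext l
    refine Fin.cases ?_ (fun i => ?_) l
    · exact (decide_eq_false (fun h => Fin.succ_ne_zero t h.symm)).symm
    · show decide (i = t) = decide (i.succ = t.succ)
      by_cases h : i = t
      · subst h; simp
      · rw [decide_eq_false h, decide_eq_false (fun h' => h (Fin.succ_inj.mp h'))]
  have hcellA : ∀ (v : Fin 4 → Bool) (j k : Fin 7), ((κ (Fin.append (Matrix.vecCons false v) zeroVec) ^^ κ (Fin.append (Matrix.vecCons false v) (fun l => decide (l = k)))) ^^ (κ (Fin.append (Matrix.vecCons false v) (fun l => decide (l = j))) ^^ κ (Fin.append (Matrix.vecCons false v) (bxor (fun l => decide (l = j)) (fun l => decide (l = k)))))) = ((κ (Fin.append (Matrix.vecCons false v) (zeroVec : Fin 7 → Bool)) ^^ κ (bxor (Fin.append (Matrix.vecCons false v) (zeroVec : Fin 7 → Bool)) (fun l => decide (l = Fin.natAdd 5 k)))) ^^ (κ (bxor (Fin.append (Matrix.vecCons false v) (zeroVec : Fin 7 → Bool)) (fun l => decide (l = Fin.natAdd 5 j))) ^^ κ (bxor (bxor (Fin.append (Matrix.vecCons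 false v) (zeroVec : Fin 7 → Bool)) (fun l => decide (l = Fin.natAdd 5 j))) (fun l => decide (l = Fin.natAdd 5 k))))) := by
    intro v j k
    have h1 := tc5_second_cell κ (Matrix.vecCons false v) zeroVec j k
    simp only [zeroVec_bxor] at h1
    exact h1
  -- the affine function on `0` and on the unit vectors
  have hAFz : ((((e ^^ ((zeroVec : Fin 4 → Bool) 0 && e0)) ^^ ((zeroVec : Fin 4 → Bool) 1 && e1)) ^^ ((zeroVec : Fin 4 → Bool) 2 && e2)) ^^ ((zeroVec : Fin 4 → Bool) 3 && e3)) = e := by simp [zeroVec]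
  have d01 : decide ((0 : Fin 4) = (1 : Fin 4)) = false := by decide
  have d02 : decide ((0 : Fin 4) = (2 : Fin 4)) = false := by decide
  have d03 : decide ((0 : Fin 4) = (3 : Fin 4)) = false := by decide
  have d10 : decide ((1 : Fin 4) = (0 : Fin 4)) = false := by decide
  have d12 : decide ((1 : Fin 4) = (2 : Fin 4)) = false := by decide
  have d13 : decide ((1 : Fin 4) = (3 : Fin 4)) = false := by decide
  have d20 : decide ((2 : Fin 4) = (0 : Fin 4)) = false := by decide
  have d21 : decide ((2 : Fin 4) = (1 : Fin 4)) = false := by decide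
  have d23 : decide ((2 : Fin 4) = (3 : Fin 4)) = false := by decide
  have d30 : decide ((3 : Fin 4) = (0 : Fin 4)) = false := by decide
  have d31 : decide ((3 : Fin 4) = (1 : Fin 4)) = false := by decide
  have d32 : decide ((3 : Fin 4) = (2 : Fin 4)) = false := by decide
  have hav0 : (![e0, e1, e2, e3] : Fin 4 → Bool) 0 = e0 := rfl
  have hav1 : (![e0, e1, e2, e3] : Fin 4 → Bool) 1 = e1 := rfl
  have hav2 : (![e0, e1, e2, e3] : Fin 4 → Bool) 2 = e2 := rfl
  have hav3 : (![e0, e1, e2, e3] : Fin 4 → Bool) 3 = e3 := rfl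
  have hAFu : ∀ t : Fin 4, ((((e ^^ ((fun l => decide (l = (t : Fin 4))) 0 && e0)) ^^ ((fun l => decide (l = (t : Fin 4))) 1 && e1)) ^^ ((fun l => decide (l = (t : Fin 4))) 2 && e2)) ^^ ((fun l => decide (l = (t : Fin 4))) 3 && e3)) = (e ^^ (![e0, e1, e2, e3] : Fin 4 → Bool) t) := by
    intro t
    have ht : t = 0 ∨ t = 1 ∨ t = 2 ∨ t = 3 := by fin_cases t <;> simp
    rcases ht with rfl | rfl | rfl | rfl
    · simp only [d10, d20, d30, hav0, Bool.false_and, Bool.xor_false]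
      cases e <;> cases e0 <;> rfl
    · simp only [d01, d21, d31, hav1, Bool.false_and, Bool.xor_false]
      cases e <;> cases e1 <;> rfl
    · simp only [d02, d12, d32, hav2, Bool.false_and, Bool.xor_false]
      cases e <;> cases e2 <;> rfl
    · simp only [d03, d13, d23, hav3, Bool.false_and, Bool.xor_false]
      cases e <;> cases e3 <;> rfl
  -- the first differences `g_j(v) = f_v(0) ⊕ f_v(e_j)` are quadratics in `v` vanishing on the zero cells
  have hB : ∀ (j : Fin 7) (s t x : Fin 4 → Bool),
      (((κ (Fin.append (Matrix.vecCons false x) (zeroVec : Fin 7 → Bool)) ^^ κ (bxor (Fin.append (Matrix.vecCons false x) (zeroVec : Fin 7 → Bool)) (fun l => decide (l = Fin.natAdd 5 j)))) ^^ (κ (Fin.append (Matrix.vecCons false (bxor x t)) (zeroVec : Fin 7 → Bool)) ^^ κ (bxor (Fin.append (Matrix.vecCons false (bxor x t)) (zeroVec : Fin 7 → Bool)) (fun l => decide (l = Fin.natAdd 5 j))))) ^^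
        ((κ (Fin.append (Matrix.vecCons false (bxor x s)) (zeroVec : Fin 7 → Bool)) ^^ κ (bxor (Fin.append (Matrix.vecCons false (bxor x s)) (zeroVec : Fin 7 → Bool)) (fun l => decide (l = Fin.natAdd 5 j)))) ^^ (κ (Fin.append (Matrix.vecCons false (bxor (bxor x s) t)) (zeroVec : Fin 7 → Bool)) ^^ κ (bxor (Fin.append (Matrix.vecCons false (bxor (bxor x s) t)) (zeroVec : Fin 7 → Bool)) (fun l => decide (l = Fin.natAdd 5 j)))))) =
      ((((κ zeroVec ^^ κ (bxor zeroVec (fun l => decide (l = Fin.natAdd 5 j)))) ^^ (κ (bxor zeroVec (Fin.append (Matrix.vecCons false t) (zeroVec : Fin 7 → Bool))) ^^ κ (bxor (bxor zeroVec (Fin.append (Matrix.vecCons false t) (zeroVec : Fin 7 → Bool))) (fun l => decide (l = Fin.natAdd 5 j))))) ^^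
            ((κ (bxor zeroVec (Fin.append (Matrix.vecCons false s) (zeroVec : Fin 7 → Bool))) ^^ κ (bxor (bxor zeroVec (Fin.append (Matrix.vecCons false s) (zeroVec : Fin 7 → Bool))) (fun l => decide (l = Fin.natAdd 5 j)))) ^^ (κ (bxor (bxor zeroVec (Fin.append (Matrix.vecCons false s) (zeroVec : Fin 7 → Bool))) (Fin.append (Matrix.vecCons false t) (zeroVec : Fin 7 → Bool))) ^^ κ (bxor (bxor (bxor zeroVec (Fin.append (Matrix.vecCons false s) (zeroVec : Fin 7 → Bool))) (Fin.append (Matrix.vecCons false t) (zeroVec : Fin 7 → Bool))) (fun l => decide (l = Fin.natAdd 5 j))))))) := by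
    intro j s t x
    simp only [hXb]
    exact tcf_third_const κ hκ _ _ _ _ _
  have hpoly : ∀ (j : Fin 7) (v : Fin 4 → Bool), (κ (Fin.append (Matrix.vecCons false v) (zeroVec : Fin 7 → Bool)) ^^ κ (bxor (Fin.append (Matrix.vecCons false v) (zeroVec : Fin 7 → Bool)) (fun l => decide (l = Fin.natAdd 5 j)))) =
      ((κ (Fin.append (Matrix.vecCons false (zeroVec : Fin 4 → Bool)) (zeroVec : Fin 7 → Bool)) ^^ κ (bxor (Fin.append (Matrix.vecCons false (zeroVec : Fin 4 → Bool)) (zeroVec : Fin 7 → Bool)) (fun l => decide (l = Fin.natAdd 5 j)))) ^^ ((v 0 && ((κ (Fin.append (Matrix.vecCons false (zeroVec : Fin 4 → Bool)) (zeroVec : Fin 7 → Bool)) ^^ κ (bxor (Fin.append (Matrix.vecCons false (zeroVec : Fin 4 → Bool)) (zeroVec : Fin 7 → Bool)) (fun l => decide (l = Fin.natAdd 5 j)))) ^^ (κ (Fin.append (Matrix.vecCons false (fun l => decide (l = (0 : Fin 4)))) (zeroVec : Fin 7 → Bool)) ^^ κ (bxor (Fin.append (Matrix.vecCons false (fun l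 => decide (l = (0 : Fin 4)))) (zeroVec : Fin 7 → Bool)) (fun l => decide (l = Fin.natAdd 5 j)))))) ^^ (v 1 && ((κ (Fin.append (Matrix.vecCons false (zeroVec : Fin 4 → Bool)) (zeroVec : Fin 7 → Bool)) ^^ κ (bxor (Fin.append (Matrix.vecCons false (zeroVec : Fin 4 → Bool)) (zeroVec : Fin 7 → Bool)) (fun l => decide (l = Fin.natAdd 5 j)))) ^^ (κ (Fin.append (Matrix.vecCons false (fun l => decide (l = (1 : Fin 4)))) (zeroVec : Fin 7 → Bool)) ^^ κ (bxor (Fin.append (Matrix.vecCons false (fun l => decide (l = (1 : Fin 4)))) (zeroVec : Fin 7 → Bool)) (fun l => decide (l = Fin.natAdd 5 j)))))) ^^ (v 2 && ((κ (Fin.append (Matrix.vecCons false (zeroVec : Fin 4 → Bool)) (zeroVec : Fin 7 → Bool)) ^^ κ (bxor (Fin.append (Matrix.vecCons false (zeroVec : Fin 4 → Bool)) (zeroVec : Fin 7 → Bool)) (fun l => decide (l = Fin.natAdd 5 j)))) ^^ (κ (Fin.append (Matrix.vecCons false (fun l => decide (l = (2 : Fin 4)))) (zeroVec : Fin 7 →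 Bool)) ^^ κ (bxor (Fin.append (Matrix.vecCons false (fun l => decide (l = (2 : Fin 4)))) (zeroVec : Fin 7 → Bool)) (fun l => decide (l = Fin.natAdd 5 j)))))) ^^ (v 3 && ((κ (Fin.append (Matrix.vecCons false (zeroVec : Fin 4 → Bool)) (zeroVec : Fin 7 → Bool)) ^^ κ (bxor (Fin.append (Matrix.vecCons false (zeroVec : Fin 4 → Bool)) (zeroVec : Fin 7 → Bool)) (fun l => decide (l = Fin.natAdd 5 j)))) ^^ (κ (Fin.append (Matrix.vecCons false (fun l => decide (l = (3 : Fin 4)))) (zeroVec : Fin 7 → Bool)) ^^ κ (bxor (Fin.append (Matrix.vecCons false (fun l => decide (l = (3 : Fin 4)))) (zeroVec : Fin 7 → Bool)) (fun l => decide (l = Fin.natAdd 5 j))))))) ^^ (((v 0 && v 1) && ((((κ zeroVec ^^ κ (bxor zeroVec (fun l => decide (l = Fin.natAdd 5 j)))) ^^ (κ (bxor zeroVec (Fin.append (Matrix.vecCons false (fun l => decide (l = (1 : Fin 4)))) (zeroVec : Fin 7 → Bool))) ^^ κ (bxor (bxor zeroVec (Fin.append (Matrix.vecCons false (fun l =>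 decide (l = (1 : Fin 4)))) (zeroVec : Fin 7 → Bool))) (fun l => decide (l = Fin.natAdd 5 j))))) ^^
            ((κ (bxor zeroVec (Fin.append (Matrix.vecCons false (fun l => decide (l = (0 : Fin 4)))) (zeroVec : Fin 7 → Bool))) ^^ κ (bxor (bxor zeroVec (Fin.append (Matrix.vecCons false (fun l => decide (l = (0 : Fin 4)))) (zeroVec : Fin 7 → Bool))) (fun l => decide (l = Fin.natAdd 5 j)))) ^^ (κ (bxor (bxor zeroVec (Fin.append (Matrix.vecCons false (fun l => decide (l = (0 : Fin 4)))) (zeroVec : Fin 7 → Bool))) (Fin.append (Matrix.vecCons false (fun l => decide (l = (1 : Fin 4)))) (zeroVec : Fin 7 → Bool))) ^^ κ (bxor (bxor (bxor zeroVec (Fin.append (Matrix.vecCons false (fun l => decide (l = (0 : Fin 4)))) (zeroVec : Fin 7 → Bool))) (Fin.append (Matrix.vecCons false (fun l => decide (l = (1 : Fin 4)))) (zeroVec : Fin 7 → Bool))) (fun l => decide (l = Fin.natAdd 5 j)))))))) ^^ ((v 0 && v 2) && ((((κ zeroVec ^^ κ (bxor zeroVec (fun l => decide (l = Fin.natAdd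 5 j)))) ^^ (κ (bxor zeroVec (Fin.append (Matrix.vecCons false (fun l => decide (l = (2 : Fin 4)))) (zeroVec : Fin 7 → Bool))) ^^ κ (bxor (bxor zeroVec (Fin.append (Matrix.vecCons false (fun l => decide (l = (2 : Fin 4)))) (zeroVec : Fin 7 → Bool))) (fun l => decide (l = Fin.natAdd 5 j))))) ^^
            ((κ (bxor zeroVec (Fin.append (Matrix.vecCons false (fun l => decide (l = (0 : Fin 4)))) (zeroVec : Fin 7 → Bool))) ^^ κ (bxor (bxor zeroVec (Fin.append (Matrix.vecCons false (fun l => decide (l = (0 : Fin 4)))) (zeroVec : Fin 7 → Bool))) (fun l => decide (l = Fin.natAdd 5 j)))) ^^ (κ (bxor (bxor zeroVec (Fin.append (Matrix.vecCons false (fun l => decide (l = (0 : Fin 4)))) (zeroVec : Fin 7 → Bool))) (Fin.append (Matrix.vecCons false (fun l => decide (l = (2 : Fin 4)))) (zeroVec : Fin 7 → Bool))) ^^ κ (bxor (bxor (bxor zeroVec (Fin.append (Matrix.vecCons false (fun l => decide (l = (0 : Fin 4)))) (zeroVec : Fin 7 → Bool))) (Fin.append (Matrix.vecCons false (fun l =>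 decide (l = (2 : Fin 4)))) (zeroVec : Fin 7 → Bool))) (fun l => decide (l = Fin.natAdd 5 j)))))))) ^^ ((v 0 && v 3) && ((((κ zeroVec ^^ κ (bxor zeroVec (fun l => decide (l = Fin.natAdd 5 j)))) ^^ (κ (bxor zeroVec (Fin.append (Matrix.vecCons false (fun l => decide (l = (3 : Fin 4)))) (zeroVec : Fin 7 → Bool))) ^^ κ (bxor (bxor zeroVec (Fin.append (Matrix.vecCons false (fun l => decide (l = (3 : Fin 4)))) (zeroVec : Fin 7 → Bool))) (fun l => decide (l = Fin.natAdd 5 j))))) ^^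
            ((κ (bxor zeroVec (Fin.append (Matrix.vecCons false (fun l => decide (l = (0 : Fin 4)))) (zeroVec : Fin 7 → Bool))) ^^ κ (bxor (bxor zeroVec (Fin.append (Matrix.vecCons false (fun l => decide (l = (0 : Fin 4)))) (zeroVec : Fin 7 → Bool))) (fun l => decide (l = Fin.natAdd 5 j)))) ^^ (κ (bxor (bxor zeroVec (Fin.append (Matrix.vecCons false (fun l => decide (l = (0 : Fin 4)))) (zeroVec : Fin 7 → Bool))) (Fin.append (Matrix.vecCons false (fun l => decide (l = (3 : Fin 4)))) (zeroVec : Fin 7 → Bool))) ^^ κ (bxor (bxor (bxor zeroVec (Fin.append (Matrix.vecCons false (fun l => decide (l = (0 : Fin 4)))) (zeroVec : Fin 7 → Bool))) (Fin.append (Matrix.vecCons false (fun l => decide (l = (3 : Fin 4)))) (zeroVec : Fin 7 → Bool))) (fun l => decide (l = Fin.natAdd 5 j)))))))) ^^ ((v 1 && v 2) && ((((κ zeroVec ^^ κ (bxor zeroVec (fun l => decide (l = Fin.natAdd 5 j)))) ^^ (κ (bxor zeroVec (Fin.append (Matrix.vecCons false (fun l => decide (l = (2 : Fin 4)))) (zeroVec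 : Fin 7 → Bool))) ^^ κ (bxor (bxor zeroVec (Fin.append (Matrix.vecCons false (fun l => decide (l = (2 : Fin 4)))) (zeroVec : Fin 7 → Bool))) (fun l => decide (l = Fin.natAdd 5 j))))) ^^
            ((κ (bxor zeroVec (Fin.append (Matrix.vecCons false (fun l => decide (l = (1 : Fin 4)))) (zeroVec : Fin 7 → Bool))) ^^ κ (bxor (bxor zeroVec (Fin.append (Matrix.vecCons false (fun l => decide (l = (1 : Fin 4)))) (zeroVec : Fin 7 → Bool))) (fun l => decide (l = Fin.natAdd 5 j)))) ^^ (κ (bxor (bxor zeroVec (Fin.append (Matrix.vecCons false (fun l => decide (l = (1 : Fin 4)))) (zeroVec : Fin 7 → Bool))) (Fin.append (Matrix.vecCons false (fun l => decide (l = (2 : Fin 4)))) (zeroVec : Fin 7 → Bool))) ^^ κ (bxor (bxor (bxor zeroVec (Fin.append (Matrix.vecCons false (fun l => decide (l = (1 : Fin 4)))) (zeroVec : Fin 7 → Bool))) (Fin.append (Matrix.vecCons false (fun l => decide (l = (2 : Fin 4)))) (zeroVec : Fin 7 → Bool))) (fun l => decide (l = Fin.natAdd 5 j)))))))) ^^ ((v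 1 && v 3) && ((((κ zeroVec ^^ κ (bxor zeroVec (fun l => decide (l = Fin.natAdd 5 j)))) ^^ (κ (bxor zeroVec (Fin.append (Matrix.vecCons false (fun l => decide (l = (3 : Fin 4)))) (zeroVec : Fin 7 → Bool))) ^^ κ (bxor (bxor zeroVec (Fin.append (Matrix.vecCons false (fun l => decide (l = (3 : Fin 4)))) (zeroVec : Fin 7 → Bool))) (fun l => decide (l = Fin.natAdd 5 j))))) ^^
            ((κ (bxor zeroVec (Fin.append (Matrix.vecCons false (fun l => decide (l = (1 : Fin 4)))) (zeroVec : Fin 7 → Bool))) ^^ κ (bxor (bxor zeroVec (Fin.append (Matrix.vecCons false (fun l => decide (l = (1 : Fin 4)))) (zeroVec : Fin 7 → Bool))) (fun l => decide (l = Fin.natAdd 5 j)))) ^^ (κ (bxor (bxor zeroVec (Fin.append (Matrix.vecCons false (fun l => decide (l = (1 : Fin 4)))) (zeroVec : Fin 7 → Bool))) (Fin.append (Matrix.vecCons false (fun l => decide (l = (3 : Fin 4)))) (zeroVec : Fin 7 → Bool))) ^^ κ (bxor (bxor (bxor zeroVec (Fin.append (Matrix.vecCons false (fun l => decide (l = (1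 : Fin 4)))) (zeroVec : Fin 7 → Bool))) (Fin.append (Matrix.vecCons false (fun l => decide (l = (3 : Fin 4)))) (zeroVec : Fin 7 → Bool))) (fun l => decide (l = Fin.natAdd 5 j)))))))) ^^ ((v 2 && v 3) && ((((κ zeroVec ^^ κ (bxor zeroVec (fun l => decide (l = Fin.natAdd 5 j)))) ^^ (κ (bxor zeroVec (Fin.append (Matrix.vecCons false (fun l => decide (l = (3 : Fin 4)))) (zeroVec : Fin 7 → Bool))) ^^ κ (bxor (bxor zeroVec (Fin.append (Matrix.vecCons false (fun l => decide (l = (3 : Fin 4)))) (zeroVec : Fin 7 → Bool))) (fun l => decide (l = Fin.natAdd 5 j))))) ^^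
            ((κ (bxor zeroVec (Fin.append (Matrix.vecCons false (fun l => decide (l = (2 : Fin 4)))) (zeroVec : Fin 7 → Bool))) ^^ κ (bxor (bxor zeroVec (Fin.append (Matrix.vecCons false (fun l => decide (l = (2 : Fin 4)))) (zeroVec : Fin 7 → Bool))) (fun l => decide (l = Fin.natAdd 5 j)))) ^^ (κ (bxor (bxor zeroVec (Fin.append (Matrix.vecCons false (fun l => decide (l = (2 : Fin 4)))) (zeroVec : Fin 7 → Bool))) (Fin.append (Matrix.vecCons false (fun l => decide (l = (3 : Fin 4)))) (zeroVec : Fin 7 → Bool))) ^^ κ (bxor (bxor (bxor zeroVec (Fin.append (Matrix.vecCons false (fun l => decide (l = (2 : Fin 4)))) (zeroVec : Fin 7 → Bool))) (Fin.append (Matrix.vecCons false (fun l => decide (l = (3 : Fin 4)))) (zeroVec : Fin 7 → Bool))) (fun l => decide (l = Fin.natAdd 5 j)))))))))) :=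
    fun j v => tq0_quad_poly (fun v => (κ (Fin.append (Matrix.vecCons false v) (zeroVec : Fin 7 → Bool)) ^^ κ (bxor (Fin.append (Matrix.vecCons false v) (zeroVec : Fin 7 → Bool)) (fun l => decide (l = Fin.natAdd 5 j)))))
      (fun s t => ((((κ zeroVec ^^ κ (bxor zeroVec (fun l => decide (l = Fin.natAdd 5 j)))) ^^ (κ (bxor zeroVec (Fin.append (Matrix.vecCons false t) (zeroVec : Fin 7 → Bool))) ^^ κ (bxor (bxor zeroVec (Fin.append (Matrix.vecCons false t) (zeroVec : Fin 7 → Bool))) (fun l => decide (l = Fin.natAdd 5 j))))) ^^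
            ((κ (bxor zeroVec (Fin.append (Matrix.vecCons false s) (zeroVec : Fin 7 → Bool))) ^^ κ (bxor (bxor zeroVec (Fin.append (Matrix.vecCons false s) (zeroVec : Fin 7 → Bool))) (fun l => decide (l = Fin.natAdd 5 j)))) ^^ (κ (bxor (bxor zeroVec (Fin.append (Matrix.vecCons false s) (zeroVec : Fin 7 → Bool))) (Fin.append (Matrix.vecCons false t) (zeroVec : Fin 7 → Bool))) ^^ κ (bxor (bxor (bxor zeroVec (Fin.append (Matrix.vecCons false s) (zeroVec : Fin 7 → Bool))) (Fin.append (Matrix.vecCons false t) (zeroVec : Fin 7 → Bool))) (fun l => decide (l = Fin.natAdd 5 j)))))))) (hB j) v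
  have hgz : ∀ (j : Fin 7) (v : Fin 4 → Bool), ((v 0 && v 1) ^^ (v 2 && v 3)) = false → ((((e ^^ (v 0 && e0)) ^^ (v 1 && e1)) ^^ (v 2 && e2)) ^^ (v 3 && e3)) = false → (κ (Fin.append (Matrix.vecCons false v) (zeroVec : Fin 7 → Bool)) ^^ κ (bxor (Fin.append (Matrix.vecCons false v) (zeroVec : Fin 7 → Bool)) (fun l => decide (l = Fin.natAdd 5 j)))) = false := by
    intro j v hv hα
    have h0 := hzero v hv hα zeroVec
    have h1 := hzero v hv hα (fun l => decide (l = j))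
    rw [hcell v (fun l => decide (l = j)), ← tc5_unit_right] at h1
    rw [h0, h1]; rfl
  have hQ6 : ∀ j : Fin 7, ∃ ε m0 m1 m2 m3 : Bool,
      ((((κ zeroVec ^^ κ (bxor zeroVec (fun l => decide (l = Fin.natAdd 5 j)))) ^^ (κ (bxor zeroVec (Fin.append (Matrix.vecCons false (fun l => decide (l = (1 : Fin 4)))) (zeroVec : Fin 7 → Bool))) ^^ κ (bxor (bxor zeroVec (Fin.append (Matrix.vecCons false (fun l => decide (l = (1 : Fin 4)))) (zeroVec : Fin 7 → Bool))) (fun l => decide (l = Fin.natAdd 5 j))))) ^^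
            ((κ (bxor zeroVec (Fin.append (Matrix.vecCons false (fun l => decide (l = (0 : Fin 4)))) (zeroVec : Fin 7 → Bool))) ^^ κ (bxor (bxor zeroVec (Fin.append (Matrix.vecCons false (fun l => decide (l = (0 : Fin 4)))) (zeroVec : Fin 7 → Bool))) (fun l => decide (l = Fin.natAdd 5 j)))) ^^ (κ (bxor (bxor zeroVec (Fin.append (Matrix.vecCons false (fun l => decide (l = (0 : Fin 4)))) (zeroVec : Fin 7 → Bool))) (Fin.append (Matrix.vecCons false (fun l => decide (l = (1 : Fin 4)))) (zeroVec : Fin 7 → Bool))) ^^ κ (bxor (bxor (bxor zeroVec (Fin.append (Matrix.vecCons false (fun l => decide (l = (0 : Fin 4)))) (zeroVec : Fin 7 → Bool))) (Fin.append (Matrix.vecCons false (fun l => decide (l = (1 : Fin 4)))) (zeroVec : Fin 7 → Bool))) (fun l => decide (l = Fin.natAdd 5 j))))))) = ((ε ^^ (e0 && m1)) ^^ (e1 && m0)) ∧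
      ((((κ zeroVec ^^ κ (bxor zeroVec (fun l => decide (l = Fin.natAdd 5 j)))) ^^ (κ (bxor zeroVec (Fin.append (Matrix.vecCons false (fun l => decide (l = (2 : Fin 4)))) (zeroVec : Fin 7 → Bool))) ^^ κ (bxor (bxor zeroVec (Fin.append (Matrix.vecCons false (fun l => decide (l = (2 : Fin 4)))) (zeroVec : Fin 7 → Bool))) (fun l => decide (l = Fin.natAdd 5 j))))) ^^
            ((κ (bxor zeroVec (Fin.append (Matrix.vecCons false (fun l => decide (l = (0 : Fin 4)))) (zeroVec : Fin 7 → Bool))) ^^ κ (bxor (bxor zeroVec (Fin.append (Matrix.vecCons false (fun l => decide (l = (0 : Fin 4)))) (zeroVec : Fin 7 → Bool))) (fun l => decide (l = Fin.natAdd 5 j)))) ^^ (κ (bxor (bxor zeroVec (Fin.append (Matrix.vecCons false (fun l => decide (l = (0 : Fin 4)))) (zeroVec : Fin 7 → Bool))) (Fin.append (Matrix.vecCons false (fun l => decide (l = (2 : Fin 4)))) (zeroVec : Fin 7 → Bool))) ^^ κ (bxor (bxor (bxor zeroVec (Fin.append (Matrix.vecCons false (fun l => decide (l = (0 : Fin 4))))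 (zeroVec : Fin 7 → Bool))) (Fin.append (Matrix.vecCons false (fun l => decide (l = (2 : Fin 4)))) (zeroVec : Fin 7 → Bool))) (fun l => decide (l = Fin.natAdd 5 j))))))) = ((e0 && m2) ^^ (e2 && m0)) ∧
      ((((κ zeroVec ^^ κ (bxor zeroVec (fun l => decide (l = Fin.natAdd 5 j)))) ^^ (κ (bxor zeroVec (Fin.append (Matrix.vecCons false (fun l => decide (l = (3 : Fin 4)))) (zeroVec : Fin 7 → Bool))) ^^ κ (bxor (bxor zeroVec (Fin.append (Matrix.vecCons false (fun l => decide (l = (3 : Fin 4)))) (zeroVec : Fin 7 → Bool))) (fun l => decide (l = Fin.natAdd 5 j))))) ^^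
            ((κ (bxor zeroVec (Fin.append (Matrix.vecCons false (fun l => decide (l = (0 : Fin 4)))) (zeroVec : Fin 7 → Bool))) ^^ κ (bxor (bxor zeroVec (Fin.append (Matrix.vecCons false (fun l => decide (l = (0 : Fin 4)))) (zeroVec : Fin 7 → Bool))) (fun l => decide (l = Fin.natAdd 5 j)))) ^^ (κ (bxor (bxor zeroVec (Fin.append (Matrix.vecCons false (fun l => decide (l = (0 : Fin 4)))) (zeroVec : Fin 7 → Bool))) (Fin.append (Matrix.vecCons false (fun l => decide (l = (3 : Fin 4)))) (zeroVec : Fin 7 → Bool))) ^^ κ (bxor (bxor (bxor zeroVec (Fin.append (Matrix.vecCons false (fun l => decide (l = (0 : Fin 4)))) (zeroVec : Fin 7 → Bool))) (Fin.append (Matrix.vecCons false (fun l => decide (l = (3 : Fin 4)))) (zeroVec : Fin 7 → Bool))) (fun l => decide (l = Fin.natAdd 5 j))))))) = ((e0 && m3) ^^ (e3 && m0)) ∧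
      ((((κ zeroVec ^^ κ (bxor zeroVec (fun l => decide (l = Fin.natAdd 5 j)))) ^^ (κ (bxor zeroVec (Fin.append (Matrix.vecCons false (fun l => decide (l = (2 : Fin 4)))) (zeroVec : Fin 7 → Bool))) ^^ κ (bxor (bxor zeroVec (Fin.append (Matrix.vecCons false (fun l => decide (l = (2 : Fin 4)))) (zeroVec : Fin 7 → Bool))) (fun l => decide (l = Fin.natAdd 5 j))))) ^^
            ((κ (bxor zeroVec (Fin.append (Matrix.vecCons false (fun l => decide (l = (1 : Fin 4)))) (zeroVec : Fin 7 → Bool))) ^^ κ (bxor (bxor zeroVec (Fin.append (Matrix.vecCons false (fun l => decide (l = (1 : Fin 4)))) (zeroVec : Fin 7 → Bool))) (fun l => decide (l = Fin.natAdd 5 j)))) ^^ (κ (bxor (bxor zeroVec (Fin.append (Matrix.vecCons false (fun l => decide (l = (1 : Fin 4)))) (zeroVec : Fin 7 → Bool))) (Fin.append (Matrix.vecCons false (fun l => decide (l = (2 : Fin 4)))) (zeroVec : Fin 7 → Bool))) ^^ κ (bxor (bxor (bxor zeroVec (Fin.append (Matrix.vecCons false (fun l => decide (l = (1 : Fin 4))))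 (zeroVec : Fin 7 → Bool))) (Fin.append (Matrix.vecCons false (fun l => decide (l = (2 : Fin 4)))) (zeroVec : Fin 7 → Bool))) (fun l => decide (l = Fin.natAdd 5 j))))))) = ((e1 && m2) ^^ (e2 && m1)) ∧
      ((((κ zeroVec ^^ κ (bxor zeroVec (fun l => decide (l = Fin.natAdd 5 j)))) ^^ (κ (bxor zeroVec (Fin.append (Matrix.vecCons false (fun l => decide (l = (3 : Fin 4)))) (zeroVec : Fin 7 → Bool))) ^^ κ (bxor (bxor zeroVec (Fin.append (Matrix.vecCons false (fun l => decide (l = (3 : Fin 4)))) (zeroVec : Fin 7 → Bool))) (fun l => decide (l = Fin.natAdd 5 j))))) ^^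
            ((κ (bxor zeroVec (Fin.append (Matrix.vecCons false (fun l => decide (l = (1 : Fin 4)))) (zeroVec : Fin 7 → Bool))) ^^ κ (bxor (bxor zeroVec (Fin.append (Matrix.vecCons false (fun l => decide (l = (1 : Fin 4)))) (zeroVec : Fin 7 → Bool))) (fun l => decide (l = Fin.natAdd 5 j)))) ^^ (κ (bxor (bxor zeroVec (Fin.append (Matrix.vecCons false (fun l => decide (l = (1 : Fin 4)))) (zeroVec : Fin 7 → Bool))) (Fin.append (Matrix.vecCons false (fun l => decide (l = (3 : Fin 4)))) (zeroVec : Fin 7 → Bool))) ^^ κ (bxor (bxor (bxor zeroVec (Fin.append (Matrix.vecCons false (fun l => decide (l = (1 : Fin 4)))) (zeroVec : Fin 7 → Bool))) (Fin.append (Matrix.vecCons false (fun l => decide (l = (3 : Fin 4)))) (zeroVec : Fin 7 → Bool))) (fun l => decide (l = Fin.natAdd 5 j))))))) = ((e1 && m3) ^^ (e3 && m1)) ∧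
      ((((κ zeroVec ^^ κ (bxor zeroVec (fun l => decide (l = Fin.natAdd 5 j)))) ^^ (κ (bxor zeroVec (Fin.append (Matrix.vecCons false (fun l => decide (l = (3 : Fin 4)))) (zeroVec : Fin 7 → Bool))) ^^ κ (bxor (bxor zeroVec (Fin.append (Matrix.vecCons false (fun l => decide (l = (3 : Fin 4)))) (zeroVec : Fin 7 → Bool))) (fun l => decide (l = Fin.natAdd 5 j))))) ^^
            ((κ (bxor zeroVec (Fin.append (Matrix.vecCons false (fun l => decide (l = (2 : Fin 4)))) (zeroVec : Fin 7 → Bool))) ^^ κ (bxor (bxor zeroVec (Fin.append (Matrix.vecCons false (fun l => decide (l = (2 : Fin 4)))) (zeroVec : Fin 7 → Bool))) (fun l => decide (l = Fin.natAdd 5 j)))) ^^ (κ (bxor (bxor zeroVec (Fin.append (Matrix.vecCons false (fun l => decide (l = (2 : Fin 4)))) (zeroVec : Fin 7 → Bool))) (Fin.append (Matrix.vecCons false (fun l => decide (l = (3 : Fin 4)))) (zeroVec : Fin 7 → Bool))) ^^ κ (bxor (bxor (bxor zeroVec (Fin.append (Matrix.vecCons false (fun l => decide (l = (2 : Fin 4))))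 (zeroVec : Fin 7 → Bool))) (Fin.append (Matrix.vecCons false (fun l => decide (l = (3 : Fin 4)))) (zeroVec : Fin 7 → Bool))) (fun l => decide (l = Fin.natAdd 5 j))))))) = ((ε ^^ (e2 && m3)) ^^ (e3 && m2)) := by
    intro j
    refine tq0_quad_six_core e0 e1 e2 e3 hA ((κ (Fin.append (Matrix.vecCons false (zeroVec : Fin 4 → Bool)) (zeroVec : Fin 7 → Bool)) ^^ κ (bxor (Fin.append (Matrix.vecCons false (zeroVec : Fin 4 → Bool)) (zeroVec : Fin 7 → Bool)) (fun l => decide (l = Fin.natAdd 5 j)))))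
      ((κ (Fin.append (Matrix.vecCons false (zeroVec : Fin 4 → Bool)) (zeroVec : Fin 7 → Bool)) ^^ κ (bxor (Fin.append (Matrix.vecCons false (zeroVec : Fin 4 → Bool)) (zeroVec : Fin 7 → Bool)) (fun l => decide (l = Fin.natAdd 5 j)))) ^^ (κ (Fin.append (Matrix.vecCons false (fun l => decide (l = (0 : Fin 4)))) (zeroVec : Fin 7 → Bool)) ^^ κ (bxor (Fin.append (Matrix.vecCons false (fun l => decide (l = (0 : Fin 4)))) (zeroVec : Fin 7 → Bool)) (fun l => decide (l = Fin.natAdd 5 j))))) ((κ (Fin.append (Matrix.vecCons false (zeroVec : Fin 4 → Bool)) (zeroVec : Fin 7 → Bool)) ^^ κ (bxor (Fin.append (Matrix.vecCons false (zeroVec : Fin 4 → Bool)) (zeroVec : Fin 7 → Bool)) (fun l => decide (l = Fin.natAdd 5 j)))) ^^ (κ (Fin.append (Matrix.vecCons false (fun l => decide (l = (1 : Fin 4)))) (zeroVec : Fin 7 → Bool)) ^^ κ (bxor (Fin.append (Matrix.vecCons false (fun l => decide (l = (1 : Fin 4)))) (zeroVec : Fin 7 → Bool)) (fun l => decide (l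 = Fin.natAdd 5 j)))))
      ((κ (Fin.append (Matrix.vecCons false (zeroVec : Fin 4 → Bool)) (zeroVec : Fin 7 → Bool)) ^^ κ (bxor (Fin.append (Matrix.vecCons false (zeroVec : Fin 4 → Bool)) (zeroVec : Fin 7 → Bool)) (fun l => decide (l = Fin.natAdd 5 j)))) ^^ (κ (Fin.append (Matrix.vecCons false (fun l => decide (l = (2 : Fin 4)))) (zeroVec : Fin 7 → Bool)) ^^ κ (bxor (Fin.append (Matrix.vecCons false (fun l => decide (l = (2 : Fin 4)))) (zeroVec : Fin 7 → Bool)) (fun l => decide (l = Fin.natAdd 5 j))))) ((κ (Fin.append (Matrix.vecCons false (zeroVec : Fin 4 → Bool)) (zeroVec : Fin 7 → Bool)) ^^ κ (bxor (Fin.append (Matrix.vecCons false (zeroVec : Fin 4 → Bool)) (zeroVec : Fin 7 → Bool)) (fun l => decide (l = Fin.natAdd 5 j)))) ^^ (κ (Fin.append (Matrix.vecCons false (fun l => decide (l = (3 : Fin 4)))) (zeroVec : Fin 7 → Bool)) ^^ κ (bxor (Fin.append (Matrix.vecCons false (fun l => decide (l = (3 : Fin 4)))) (zeroVec : Fin 7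 → Bool)) (fun l => decide (l = Fin.natAdd 5 j)))))
      ((((κ zeroVec ^^ κ (bxor zeroVec (fun l => decide (l = Fin.natAdd 5 j)))) ^^ (κ (bxor zeroVec (Fin.append (Matrix.vecCons false (fun l => decide (l = (1 : Fin 4)))) (zeroVec : Fin 7 → Bool))) ^^ κ (bxor (bxor zeroVec (Fin.append (Matrix.vecCons false (fun l => decide (l = (1 : Fin 4)))) (zeroVec : Fin 7 → Bool))) (fun l => decide (l = Fin.natAdd 5 j))))) ^^
            ((κ (bxor zeroVec (Fin.append (Matrix.vecCons false (fun l => decide (l = (0 : Fin 4)))) (zeroVec : Fin 7 → Bool))) ^^ κ (bxor (bxor zeroVec (Fin.append (Matrix.vecCons false (fun l => decide (l = (0 : Fin 4)))) (zeroVec : Fin 7 → Bool))) (fun l => decide (l = Fin.natAdd 5 j)))) ^^ (κ (bxor (bxor zeroVec (Fin.append (Matrix.vecCons false (fun l => decide (l = (0 : Fin 4)))) (zeroVec : Fin 7 → Bool))) (Fin.append (Matrix.vecCons false (fun l => decide (l = (1 : Fin 4)))) (zeroVec : Fin 7 → Bool))) ^^ κ (bxor (bxor (bxor zeroVec (Fin.append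 (Matrix.vecCons false (fun l => decide (l = (0 : Fin 4)))) (zeroVec : Fin 7 → Bool))) (Fin.append (Matrix.vecCons false (fun l => decide (l = (1 : Fin 4)))) (zeroVec : Fin 7 → Bool))) (fun l => decide (l = Fin.natAdd 5 j))))))) ((((κ zeroVec ^^ κ (bxor zeroVec (fun l => decide (l = Fin.natAdd 5 j)))) ^^ (κ (bxor zeroVec (Fin.append (Matrix.vecCons false (fun l => decide (l = (2 : Fin 4)))) (zeroVec : Fin 7 → Bool))) ^^ κ (bxor (bxor zeroVec (Fin.append (Matrix.vecCons false (fun l => decide (l = (2 : Fin 4)))) (zeroVec : Fin 7 → Bool))) (fun l => decide (l = Fin.natAdd 5 j))))) ^^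
            ((κ (bxor zeroVec (Fin.append (Matrix.vecCons false (fun l => decide (l = (0 : Fin 4)))) (zeroVec : Fin 7 → Bool))) ^^ κ (bxor (bxor zeroVec (Fin.append (Matrix.vecCons false (fun l => decide (l = (0 : Fin 4)))) (zeroVec : Fin 7 → Bool))) (fun l => decide (l = Fin.natAdd 5 j)))) ^^ (κ (bxor (bxor zeroVec (Fin.append (Matrix.vecCons false (fun l => decide (l = (0 : Fin 4)))) (zeroVec : Fin 7 → Bool))) (Fin.append (Matrix.vecCons false (fun l => decide (l = (2 : Fin 4)))) (zeroVec : Fin 7 → Bool))) ^^ κ (bxor (bxor (bxor zeroVec (Fin.append (Matrix.vecCons false (fun l => decide (l = (0 : Fin 4)))) (zeroVec : Fin 7 → Bool))) (Fin.append (Matrix.vecCons false (fun l => decide (l = (2 : Fin 4)))) (zeroVec : Fin 7 → Bool))) (fun l => decide (l = Fin.natAdd 5 j))))))) ((((κ zeroVec ^^ κ (bxor zeroVec (fun l => decide (l = Fin.natAdd 5 j)))) ^^ (κ (bxor zeroVec (Fin.append (Matrix.vecCons false (fun l => decide (l = (3 : Fin 4)))) (zeroVec : Fin 7 → Bool)))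 ^^ κ (bxor (bxor zeroVec (Fin.append (Matrix.vecCons false (fun l => decide (l = (3 : Fin 4)))) (zeroVec : Fin 7 → Bool))) (fun l => decide (l = Fin.natAdd 5 j))))) ^^
            ((κ (bxor zeroVec (Fin.append (Matrix.vecCons false (fun l => decide (l = (0 : Fin 4)))) (zeroVec : Fin 7 → Bool))) ^^ κ (bxor (bxor zeroVec (Fin.append (Matrix.vecCons false (fun l => decide (l = (0 : Fin 4)))) (zeroVec : Fin 7 → Bool))) (fun l => decide (l = Fin.natAdd 5 j)))) ^^ (κ (bxor (bxor zeroVec (Fin.append (Matrix.vecCons false (fun l => decide (l = (0 : Fin 4)))) (zeroVec : Fin 7 → Bool))) (Fin.append (Matrix.vecCons false (fun l => decide (l = (3 : Fin 4)))) (zeroVec : Fin 7 → Bool))) ^^ κ (bxor (bxor (bxor zeroVec (Fin.append (Matrix.vecCons false (fun l => decide (l = (0 : Fin 4)))) (zeroVec : Fin 7 → Bool))) (Fin.append (Matrix.vecCons false (fun l => decide (l = (3 : Fin 4)))) (zeroVec : Fin 7 → Bool))) (fun l => decide (l = Fin.natAdd 5 j))))))) ((((κ zeroVec ^^ κ (bxor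 zeroVec (fun l => decide (l = Fin.natAdd 5 j)))) ^^ (κ (bxor zeroVec (Fin.append (Matrix.vecCons false (fun l => decide (l = (2 : Fin 4)))) (zeroVec : Fin 7 → Bool))) ^^ κ (bxor (bxor zeroVec (Fin.append (Matrix.vecCons false (fun l => decide (l = (2 : Fin 4)))) (zeroVec : Fin 7 → Bool))) (fun l => decide (l = Fin.natAdd 5 j))))) ^^
            ((κ (bxor zeroVec (Fin.append (Matrix.vecCons false (fun l => decide (l = (1 : Fin 4)))) (zeroVec : Fin 7 → Bool))) ^^ κ (bxor (bxor zeroVec (Fin.append (Matrix.vecCons false (fun l => decide (l = (1 : Fin 4)))) (zeroVec : Fin 7 → Bool))) (fun l => decide (l = Fin.natAdd 5 j)))) ^^ (κ (bxor (bxor zeroVec (Fin.append (Matrix.vecCons false (fun l => decide (l = (1 : Fin 4)))) (zeroVec : Fin 7 → Bool))) (Fin.append (Matrix.vecCons false (fun l => decide (l = (2 : Fin 4)))) (zeroVec : Fin 7 → Bool))) ^^ κ (bxor (bxor (bxor zeroVec (Fin.append (Matrix.vecCons false (fun l => decide (l = (1 : Fin 4)))) (zeroVec : Fin 7 → Bool)))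 (Fin.append (Matrix.vecCons false (fun l => decide (l = (2 : Fin 4)))) (zeroVec : Fin 7 → Bool))) (fun l => decide (l = Fin.natAdd 5 j))))))) ((((κ zeroVec ^^ κ (bxor zeroVec (fun l => decide (l = Fin.natAdd 5 j)))) ^^ (κ (bxor zeroVec (Fin.append (Matrix.vecCons false (fun l => decide (l = (3 : Fin 4)))) (zeroVec : Fin 7 → Bool))) ^^ κ (bxor (bxor zeroVec (Fin.append (Matrix.vecCons false (fun l => decide (l = (3 : Fin 4)))) (zeroVec : Fin 7 → Bool))) (fun l => decide (l = Fin.natAdd 5 j))))) ^^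
            ((κ (bxor zeroVec (Fin.append (Matrix.vecCons false (fun l => decide (l = (1 : Fin 4)))) (zeroVec : Fin 7 → Bool))) ^^ κ (bxor (bxor zeroVec (Fin.append (Matrix.vecCons false (fun l => decide (l = (1 : Fin 4)))) (zeroVec : Fin 7 → Bool))) (fun l => decide (l = Fin.natAdd 5 j)))) ^^ (κ (bxor (bxor zeroVec (Fin.append (Matrix.vecCons false (fun l => decide (l = (1 : Fin 4)))) (zeroVec : Fin 7 → Bool))) (Fin.append (Matrix.vecCons false (fun l => decide (l = (3 : Fin 4)))) (zeroVec : Fin 7 → Bool))) ^^ κ (bxor (bxor (bxor zeroVec (Fin.append (Matrix.vecCons false (fun l => decide (l = (1 : Fin 4)))) (zeroVec : Fin 7 → Bool))) (Fin.append (Matrix.vecCons false (fun l => decide (l = (3 : Fin 4)))) (zeroVec : Fin 7 → Bool))) (fun l => decide (l = Fin.natAdd 5 j))))))) ((((κ zeroVec ^^ κ (bxor zeroVec (fun l => decide (l = Fin.natAdd 5 j)))) ^^ (κ (bxor zeroVec (Fin.append (Matrix.vecCons false (fun l => decide (l = (3 : Fin 4)))) (zeroVec : Fin 7 → Bool)))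 ^^ κ (bxor (bxor zeroVec (Fin.append (Matrix.vecCons false (fun l => decide (l = (3 : Fin 4)))) (zeroVec : Fin 7 → Bool))) (fun l => decide (l = Fin.natAdd 5 j))))) ^^
            ((κ (bxor zeroVec (Fin.append (Matrix.vecCons false (fun l => decide (l = (2 : Fin 4)))) (zeroVec : Fin 7 → Bool))) ^^ κ (bxor (bxor zeroVec (Fin.append (Matrix.vecCons false (fun l => decide (l = (2 : Fin 4)))) (zeroVec : Fin 7 → Bool))) (fun l => decide (l = Fin.natAdd 5 j)))) ^^ (κ (bxor (bxor zeroVec (Fin.append (Matrix.vecCons false (fun l => decide (l = (2 : Fin 4)))) (zeroVec : Fin 7 → Bool))) (Fin.append (Matrix.vecCons false (fun l => decide (l = (3 : Fin 4)))) (zeroVec : Fin 7 → Bool))) ^^ κ (bxor (bxor (bxor zeroVec (Fin.append (Matrix.vecCons false (fun l => decide (l = (2 : Fin 4)))) (zeroVec : Fin 7 → Bool))) (Fin.append (Matrix.vecCons false (fun l => decide (l = (3 : Fin 4)))) (zeroVec : Fin 7 → Bool))) (fun l => decide (l = Fin.natAdd 5 j)))))))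
      (fun hα => by have hg := hgz j ![false, false, false, false] (by decide) (by rw [h6]; exact hα); rw [hpoly j] at hg; exact hg)
      (fun hα => by have hg := hgz j ![false, false, false, true] (by decide) (by rw [h6]; exact hα); rw [hpoly j] at hg; exact hg)
      (fun hα => by have hg := hgz j ![false, false, true, false] (by decide) (by rw [h6]; exact hα); rw [hpoly j] at hg; exact hg)
      (fun hα => by have hg := hgz j ![false, true, false, false] (by decide) (by rw [h6]; exact hα); rw [hpoly j] at hg; exact hg)
      (fun hα => by have hg := hgz j ![false, true, false, true] (by decide) (by rw [h6]; exact hα); rw [hpoly j] at hg; exact hg)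
      (fun hα => by have hg := hgz j ![false, true, true, false] (by decide) (by rw [h6]; exact hα); rw [hpoly j] at hg; exact hg)
      (fun hα => by have hg := hgz j ![true, false, false, false] (by decide) (by rw [h6]; exact hα); rw [hpoly j] at hg; exact hg)
      (fun hα => by have hg := hgz j ![true, false, false, true] (by decide) (by rw [h6]; exact hα); rw [hpoly j] at hg; exact hg)
      (fun hα => by have hg := hgz j ![true, false, true, false] (by decide) (by rw [h6]; exact hα); rw [hpoly j] at hg; exact hg)
      (fun hα => by have hg := hgz j ![true, true, true, true] (by decide) (by rw [h6]; exact hα); rw [hpoly j] at hg; exact hg)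
  choose ε m0 m1 m2 m3 hε using hQ6
  -- symmetry of the fibre forms
  have hBsymm : ∀ (j : Fin 7) (s t : Fin 4 → Bool), ((((κ zeroVec ^^ κ (bxor zeroVec (fun l => decide (l = Fin.natAdd 5 j)))) ^^ (κ (bxor zeroVec (Fin.append (Matrix.vecCons false t) (zeroVec : Fin 7 → Bool))) ^^ κ (bxor (bxor zeroVec (Fin.append (Matrix.vecCons false t) (zeroVec : Fin 7 → Bool))) (fun l => decide (l = Fin.natAdd 5 j))))) ^^
            ((κ (bxor zeroVec (Fin.append (Matrix.vecCons false s) (zeroVec : Fin 7 → Bool))) ^^ κ (bxor (bxor zeroVec (Fin.append (Matrix.vecCons false s) (zeroVec : Fin 7 → Bool))) (fun l => decide (l = Fin.natAdd 5 j)))) ^^ (κ (bxor (bxor zeroVec (Fin.append (Matrix.vecCons false s) (zeroVec : Fin 7 → Bool))) (Fin.append (Matrix.vecCons false t) (zeroVec : Fin 7 → Bool))) ^^ κ (bxor (bxor (bxor zeroVec (Fin.append (Matrix.vecCons false s) (zeroVec : Fin 7 → Bool))) (Fin.append (Matrix.vecCons false t) (zeroVec : Fin 7 → Bool))) (fun l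 => decide (l = Fin.natAdd 5 j))))))) = ((((κ zeroVec ^^ κ (bxor zeroVec (fun l => decide (l = Fin.natAdd 5 j)))) ^^ (κ (bxor zeroVec (Fin.append (Matrix.vecCons false s) (zeroVec : Fin 7 → Bool))) ^^ κ (bxor (bxor zeroVec (Fin.append (Matrix.vecCons false s) (zeroVec : Fin 7 → Bool))) (fun l => decide (l = Fin.natAdd 5 j))))) ^^
            ((κ (bxor zeroVec (Fin.append (Matrix.vecCons false t) (zeroVec : Fin 7 → Bool))) ^^ κ (bxor (bxor zeroVec (Fin.append (Matrix.vecCons false t) (zeroVec : Fin 7 → Bool))) (fun l => decide (l = Fin.natAdd 5 j)))) ^^ (κ (bxor (bxor zeroVec (Fin.append (Matrix.vecCons false t) (zeroVec : Fin 7 → Bool))) (Fin.append (Matrix.vecCons false s) (zeroVec : Fin 7 → Bool))) ^^ κ (bxor (bxor (bxor zeroVec (Fin.append (Matrix.vecCons false t) (zeroVec : Fin 7 → Bool))) (Fin.append (Matrix.vecCons false s) (zeroVec : Fin 7 → Bool))) (fun l => decide (l = Fin.natAdd 5 j))))))) := by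
    intro j s t
    obtain ⟨hsymm, -, -, -⟩ := tcb_form_basic (fun v => (κ (Fin.append (Matrix.vecCons false v) (zeroVec : Fin 7 → Bool)) ^^ κ (bxor (Fin.append (Matrix.vecCons false v) (zeroVec : Fin 7 → Bool)) (fun l => decide (l = Fin.natAdd 5 j))))) (fun s t => ((((κ zeroVec ^^ κ (bxor zeroVec (fun l => decide (l = Fin.natAdd 5 j)))) ^^ (κ (bxor zeroVec (Fin.append (Matrix.vecCons false t) (zeroVec : Fin 7 → Bool))) ^^ κ (bxor (bxor zeroVec (Fin.append (Matrix.vecCons false t) (zeroVec : Fin 7 → Bool))) (fun l => decide (l = Fin.natAdd 5 j))))) ^^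
            ((κ (bxor zeroVec (Fin.append (Matrix.vecCons false s) (zeroVec : Fin 7 → Bool))) ^^ κ (bxor (bxor zeroVec (Fin.append (Matrix.vecCons false s) (zeroVec : Fin 7 → Bool))) (fun l => decide (l = Fin.natAdd 5 j)))) ^^ (κ (bxor (bxor zeroVec (Fin.append (Matrix.vecCons false s) (zeroVec : Fin 7 → Bool))) (Fin.append (Matrix.vecCons false t) (zeroVec : Fin 7 → Bool))) ^^ κ (bxor (bxor (bxor zeroVec (Fin.append (Matrix.vecCons false s) (zeroVec : Fin 7 → Bool))) (Fin.append (Matrix.vecCons false t) (zeroVec : Fin 7 → Bool))) (fun l => decide (l = Fin.natAdd 5 j)))))))) (hB j)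
    exact hsymm s t
  have hBalt : ∀ (j : Fin 7) (s : Fin 4 → Bool), ((((κ zeroVec ^^ κ (bxor zeroVec (fun l => decide (l = Fin.natAdd 5 j)))) ^^ (κ (bxor zeroVec (Fin.append (Matrix.vecCons false s) (zeroVec : Fin 7 → Bool))) ^^ κ (bxor (bxor zeroVec (Fin.append (Matrix.vecCons false s) (zeroVec : Fin 7 → Bool))) (fun l => decide (l = Fin.natAdd 5 j))))) ^^
            ((κ (bxor zeroVec (Fin.append (Matrix.vecCons false s) (zeroVec : Fin 7 → Bool))) ^^ κ (bxor (bxor zeroVec (Fin.append (Matrix.vecCons false s) (zeroVec : Fin 7 → Bool))) (fun l => decide (l = Fin.natAdd 5 j)))) ^^ (κ (bxor (bxor zeroVec (Fin.append (Matrix.vecCons false s) (zeroVec : Fin 7 → Bool))) (Fin.append (Matrix.vecCons false s) (zeroVec : Fin 7 → Bool))) ^^ κ (bxor (bxor (bxor zeroVec (Fin.append (Matrix.vecCons false s) (zeroVec : Fin 7 → Bool))) (Fin.append (Matrix.vecCons false s) (zeroVec : Fin 7 → Bool))) (fun l => decide (l = Fin.natAdd 5 j))))))) = false := by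
    intro j s
    obtain ⟨-, -, halt, -⟩ := tcb_form_basic (fun v => (κ (Fin.append (Matrix.vecCons false v) (zeroVec : Fin 7 → Bool)) ^^ κ (bxor (Fin.append (Matrix.vecCons false v) (zeroVec : Fin 7 → Bool)) (fun l => decide (l = Fin.natAdd 5 j))))) (fun s t => ((((κ zeroVec ^^ κ (bxor zeroVec (fun l => decide (l = Fin.natAdd 5 j)))) ^^ (κ (bxor zeroVec (Fin.append (Matrix.vecCons false t) (zeroVec : Fin 7 → Bool))) ^^ κ (bxor (bxor zeroVec (Fin.append (Matrix.vecCons false t) (zeroVec : Fin 7 → Bool))) (fun l => decide (l = Fin.natAdd 5 j))))) ^^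
            ((κ (bxor zeroVec (Fin.append (Matrix.vecCons false s) (zeroVec : Fin 7 → Bool))) ^^ κ (bxor (bxor zeroVec (Fin.append (Matrix.vecCons false s) (zeroVec : Fin 7 → Bool))) (fun l => decide (l = Fin.natAdd 5 j)))) ^^ (κ (bxor (bxor zeroVec (Fin.append (Matrix.vecCons false s) (zeroVec : Fin 7 → Bool))) (Fin.append (Matrix.vecCons false t) (zeroVec : Fin 7 → Bool))) ^^ κ (bxor (bxor (bxor zeroVec (Fin.append (Matrix.vecCons false s) (zeroVec : Fin 7 → Bool))) (Fin.append (Matrix.vecCons false t) (zeroVec : Fin 7 → Bool))) (fun l => decide (l = Fin.natAdd 5 j)))))))) (hB j)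
    exact halt s
  -- `d(v_t, v_t', z_j)` is the fibre form on unit vectors
  have hdB : ∀ (t t' : Fin 4) (j : Fin 7), d (Fin.castAdd 7 t.succ) (Fin.castAdd 7 t'.succ) (Fin.natAdd 5 j) =
      if ((((κ zeroVec ^^ κ (bxor zeroVec (fun l => decide (l = Fin.natAdd 5 j)))) ^^ (κ (bxor zeroVec (Fin.append (Matrix.vecCons false (fun l => decide (l = t'))) (zeroVec : Fin 7 → Bool))) ^^ κ (bxor (bxor zeroVec (Fin.append (Matrix.vecCons false (fun l => decide (l = t'))) (zeroVec : Fin 7 → Bool))) (fun l => decide (l = Fin.natAdd 5 j))))) ^^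
            ((κ (bxor zeroVec (Fin.append (Matrix.vecCons false (fun l => decide (l = t))) (zeroVec : Fin 7 → Bool))) ^^ κ (bxor (bxor zeroVec (Fin.append (Matrix.vecCons false (fun l => decide (l = t))) (zeroVec : Fin 7 → Bool))) (fun l => decide (l = Fin.natAdd 5 j)))) ^^ (κ (bxor (bxor zeroVec (Fin.append (Matrix.vecCons false (fun l => decide (l = t))) (zeroVec : Fin 7 → Bool))) (Fin.append (Matrix.vecCons false (fun l => decide (l = t'))) (zeroVec : Fin 7 → Bool))) ^^ κ (bxor (bxor (bxor zeroVec (Fin.append (Matrix.vecCons false (fun l => decide (l = t))) (zeroVec : Fin 7 → Bool))) (Fin.append (Matrix.vecCons false (fun l => decide (l = t'))) (zeroVec : Fin 7 → Bool))) (fun l => decide (l = Fin.natAdd 5 j))))))) = true then 1 else 0 := by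
    intro t t' j
    rw [hd, ← hXe t, ← hXe t']
  have h2 : ∀ x : ZMod 2, x + x = 0 := by decide
  -- assemble
  refine ⟨fun t => if (![e0, e1, e2, e3] : Fin 4 → Bool) t = true then 1 else 0, fun j k => if Ξ j k = true then 1 else 0,
    fun j => if ε j = true then 1 else 0, fun t j => if (![m0 j, m1 j, m2 j, m3 j] : Fin 4 → Bool) t = true then 1 else 0,
    ?_, ?_, ?_, ?_, ?_⟩
  · -- `a ≠ 0`
    beta_reduce
    revert hA
    cases e0 <;> cases e1 <;> cases e2 <;> cases e3 <;> intro hA <;>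
      first | exact absurd hA (by decide) | exact ⟨0, by decide⟩ | exact ⟨1, by decide⟩ | exact ⟨2, by decide⟩ | exact ⟨3, by decide⟩
  · -- `Ξ` symmetric
    intro j k
    beta_reduce
    have hj := hΞv v₀ j k; have hk := hΞv v₀ k j
    rw [hv₀, Bool.true_and] at hj hk
    rw [← hj, ← hk, bxor_comm (fun l => decide (l = k)) (fun l => decide (l = j))]
    cases κ (Fin.append (Matrix.vecCons false v₀) zeroVec) <;> cases κ (Fin.append (Matrix.vecCons false v₀) (fun l => decide (l = j))) <;> cases κ (Fin.append (Matrix.vecCons false v₀) (fun l => decide (l = k))) <;>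
      cases κ (Fin.append (Matrix.vecCons false v₀) (bxor (fun l => decide (l = j)) (fun l => decide (l = k)))) <;> rfl
  · -- `Ξ` alternating
    intro j
    beta_reduce
    have hj := hΞv v₀ j j
    rw [hv₀, Bool.true_and, bxor_self] at hj
    rw [← hj]
    cases κ (Fin.append (Matrix.vecCons false v₀) zeroVec) <;> cases κ (Fin.append (Matrix.vecCons false v₀) (fun l => decide (l = j))) <;> rfl
  · -- `d(v_t, z_j, z_k) = a_t Ξ_jk`
    intro t j k
    beta_reduce
    rw [hd]
    have a0 := hΞv zeroVec j k
    have a1 := hΞv (fun l => decide (l = t)) j k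
    rw [hcellA] at a0 a1
    rw [hX0, hAFz] at a0
    rw [hXe, hAFu] at a1
    simp only [zeroVec_bxor] at a0 ⊢
    rw [a0, a1]
    generalize (![e0, e1, e2, e3] : Fin 4 → Bool) t = avt
    generalize Ξ j k = x
    cases e <;> cases avt <;> cases x <;> simp
  · -- `d(v_t, v_t', z_j) = ω_tt' E_j + a_t M_t'j + a_t' M_tj`
    intro t t' j
    beta_reduce
    rw [hdB]
    obtain ⟨q01, q02, q03, q12, q13, q23⟩ := hε j
    have ht : t = 0 ∨ t = 1 ∨ t = 2 ∨ t = 3 := by fin_cases t <;> simp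
    have ht' : t' = 0 ∨ t' = 1 ∨ t' = 2 ∨ t' = 3 := by fin_cases t' <;> simp
    have hm0 : ∀ j, (![m0 j, m1 j, m2 j, m3 j] : Fin 4 → Bool) 0 = m0 j := fun j => rfl
    have hm1 : ∀ j, (![m0 j, m1 j, m2 j, m3 j] : Fin 4 → Bool) 1 = m1 j := fun j => rfl
    have hm2 : ∀ j, (![m0 j, m1 j, m2 j, m3 j] : Fin 4 → Bool) 2 = m2 j := fun j => rfl
    have hm3 : ∀ j, (![m0 j, m1 j, m2 j, m3 j] : Fin 4 → Bool) 3 = m3 j := fun j => rfl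
    rcases ht with rfl | rfl | rfl | rfl <;> rcases ht' with rfl | rfl | rfl | rfl
    · rw [hBalt, hav0, hm0, show ((if ((0 : Fin 4) = 0 ∧ (0 : Fin 4) = 1) ∨ ((0 : Fin 4) = 1 ∧ (0 : Fin 4) = 0) then (1 : ZMod 2) else 0) + (if ((0 : Fin 4) = 2 ∧ (0 : Fin 4) = 3) ∨ ((0 : Fin 4) = 3 ∧ (0 : Fin 4) = 2) then (1 : ZMod 2) else 0)) = 0 from by decide, zero_mul, zero_add, h2]; simp
    · rw [q01, hav0, hav1, hm0, hm1, show ((if ((0 : Fin 4) = 0 ∧ (1 : Fin 4) = 1) ∨ ((0 : Fin 4) = 1 ∧ (1 : Fin 4) = 0) then (1 : ZMod 2) else 0) + (if ((0 : Fin 4) = 2 ∧ (1 : Fin 4) = 3) ∨ ((0 : Fin 4) = 3 ∧ (1 : Fin 4) = 2) then (1 : ZMod 2) else 0)) = 1 from by decide]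
      generalize ε j = E0; generalize m0 j = Ma; generalize m1 j = Mb
      cases E0 <;> cases Ma <;> cases Mb <;> cases e0 <;> cases e1 <;> decide
    · rw [q02, hav0, hav2, hm0, hm2, show ((if ((0 : Fin 4) = 0 ∧ (2 : Fin 4) = 1) ∨ ((0 : Fin 4) = 1 ∧ (2 : Fin 4) = 0) then (1 : ZMod 2) else 0) + (if ((0 : Fin 4) = 2 ∧ (2 : Fin 4) = 3) ∨ ((0 : Fin 4) = 3 ∧ (2 : Fin 4) = 2) then (1 : ZMod 2) else 0)) = 0 from by decide]
      generalize ε j = E0; generalize m0 j = Ma; generalize m2 j = Mb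
      cases E0 <;> cases Ma <;> cases Mb <;> cases e0 <;> cases e2 <;> decide
    · rw [q03, hav0, hav3, hm0, hm3, show ((if ((0 : Fin 4) = 0 ∧ (3 : Fin 4) = 1) ∨ ((0 : Fin 4) = 1 ∧ (3 : Fin 4) = 0) then (1 : ZMod 2) else 0) + (if ((0 : Fin 4) = 2 ∧ (3 : Fin 4) = 3) ∨ ((0 : Fin 4) = 3 ∧ (3 : Fin 4) = 2) then (1 : ZMod 2) else 0)) = 0 from by decide]
      generalize ε j = E0; generalize m0 j = Ma; generalize m3 j = Mb
      cases E0 <;> cases Ma <;> cases Mb <;> cases e0 <;> cases e3 <;> decide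
    · rw [hBsymm, q01, hav1, hav0, hm1, hm0, show ((if ((1 : Fin 4) = 0 ∧ (0 : Fin 4) = 1) ∨ ((1 : Fin 4) = 1 ∧ (0 : Fin 4) = 0) then (1 : ZMod 2) else 0) + (if ((1 : Fin 4) = 2 ∧ (0 : Fin 4) = 3) ∨ ((1 : Fin 4) = 3 ∧ (0 : Fin 4) = 2) then (1 : ZMod 2) else 0)) = 1 from by decide]
      generalize ε j = E0; generalize m1 j = Ma; generalize m0 j = Mb
      cases E0 <;> cases Ma <;> cases Mb <;> cases e1 <;> cases e0 <;> decide
    · rw [hBalt, hav1, hm1, show ((if ((1 : Fin 4) = 0 ∧ (1 : Fin 4) = 1) ∨ ((1 : Fin 4) = 1 ∧ (1 : Fin 4) = 0) then (1 : ZMod 2) else 0) + (if ((1 : Fin 4) = 2 ∧ (1 : Fin 4) = 3) ∨ ((1 : Fin 4) = 3 ∧ (1 : Fin 4) = 2) then (1 : ZMod 2) else 0)) = 0 from by decide, zero_mul, zero_add, h2]; simp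
    · rw [q12, hav1, hav2, hm1, hm2, show ((if ((1 : Fin 4) = 0 ∧ (2 : Fin 4) = 1) ∨ ((1 : Fin 4) = 1 ∧ (2 : Fin 4) = 0) then (1 : ZMod 2) else 0) + (if ((1 : Fin 4) = 2 ∧ (2 : Fin 4) = 3) ∨ ((1 : Fin 4) = 3 ∧ (2 : Fin 4) = 2) then (1 : ZMod 2) else 0)) = 0 from by decide]
      generalize ε j = E0; generalize m1 j = Ma; generalize m2 j = Mb
      cases E0 <;> cases Ma <;> cases Mb <;> cases e1 <;> cases e2 <;> decide
    · rw [q13, hav1, hav3, hm1, hm3, show ((if ((1 : Fin 4) = 0 ∧ (3 : Fin 4) = 1) ∨ ((1 : Fin 4) = 1 ∧ (3 : Fin 4) = 0) then (1 : ZMod 2) else 0) + (if ((1 : Fin 4) = 2 ∧ (3 : Fin 4) = 3) ∨ ((1 : Fin 4) = 3 ∧ (3 : Fin 4) = 2) then (1 : ZMod 2) else 0)) = 0 from by decide]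
      generalize ε j = E0; generalize m1 j = Ma; generalize m3 j = Mb
      cases E0 <;> cases Ma <;> cases Mb <;> cases e1 <;> cases e3 <;> decide
    · rw [hBsymm, q02, hav2, hav0, hm2, hm0, show ((if ((2 : Fin 4) = 0 ∧ (0 : Fin 4) = 1) ∨ ((2 : Fin 4) = 1 ∧ (0 : Fin 4) = 0) then (1 : ZMod 2) else 0) + (if ((2 : Fin 4) = 2 ∧ (0 : Fin 4) = 3) ∨ ((2 : Fin 4) = 3 ∧ (0 : Fin 4) = 2) then (1 : ZMod 2) else 0)) = 0 from by decide]
      generalize ε j = E0; generalize m2 j = Ma; generalize m0 j = Mb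
      cases E0 <;> cases Ma <;> cases Mb <;> cases e2 <;> cases e0 <;> decide
    · rw [hBsymm, q12, hav2, hav1, hm2, hm1, show ((if ((2 : Fin 4) = 0 ∧ (1 : Fin 4) = 1) ∨ ((2 : Fin 4) = 1 ∧ (1 : Fin 4) = 0) then (1 : ZMod 2) else 0) + (if ((2 : Fin 4) = 2 ∧ (1 : Fin 4) = 3) ∨ ((2 : Fin 4) = 3 ∧ (1 : Fin 4) = 2) then (1 : ZMod 2) else 0)) = 0 from by decide]
      generalize ε j = E0; generalize m2 j = Ma; generalize m1 j = Mb
      cases E0 <;> cases Ma <;> cases Mb <;> cases e2 <;> cases e1 <;> decide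
    · rw [hBalt, hav2, hm2, show ((if ((2 : Fin 4) = 0 ∧ (2 : Fin 4) = 1) ∨ ((2 : Fin 4) = 1 ∧ (2 : Fin 4) = 0) then (1 : ZMod 2) else 0) + (if ((2 : Fin 4) = 2 ∧ (2 : Fin 4) = 3) ∨ ((2 : Fin 4) = 3 ∧ (2 : Fin 4) = 2) then (1 : ZMod 2) else 0)) = 0 from by decide, zero_mul, zero_add, h2]; simp
    · rw [q23, hav2, hav3, hm2, hm3, show ((if ((2 : Fin 4) = 0 ∧ (3 : Fin 4) = 1) ∨ ((2 : Fin 4) = 1 ∧ (3 : Fin 4) = 0) then (1 : ZMod 2) else 0) + (if ((2 : Fin 4) = 2 ∧ (3 : Fin 4) = 3) ∨ ((2 : Fin 4) = 3 ∧ (3 : Fin 4) = 2) then (1 : ZMod 2) else 0)) = 1 from by decide]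
      generalize ε j = E0; generalize m2 j = Ma; generalize m3 j = Mb
      cases E0 <;> cases Ma <;> cases Mb <;> cases e2 <;> cases e3 <;> decide
    · rw [hBsymm, q03, hav3, hav0, hm3, hm0, show ((if ((3 : Fin 4) = 0 ∧ (0 : Fin 4) = 1) ∨ ((3 : Fin 4) = 1 ∧ (0 : Fin 4) = 0) then (1 : ZMod 2) else 0) + (if ((3 : Fin 4) = 2 ∧ (0 : Fin 4) = 3) ∨ ((3 : Fin 4) = 3 ∧ (0 : Fin 4) = 2) then (1 : ZMod 2) else 0)) = 0 from by decide]
      generalize ε j = E0; generalize m3 j = Ma; generalize m0 j = Mb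
      cases E0 <;> cases Ma <;> cases Mb <;> cases e3 <;> cases e0 <;> decide
    · rw [hBsymm, q13, hav3, hav1, hm3, hm1, show ((if ((3 : Fin 4) = 0 ∧ (1 : Fin 4) = 1) ∨ ((3 : Fin 4) = 1 ∧ (1 : Fin 4) = 0) then (1 : ZMod 2) else 0) + (if ((3 : Fin 4) = 2 ∧ (1 : Fin 4) = 3) ∨ ((3 : Fin 4) = 3 ∧ (1 : Fin 4) = 2) then (1 : ZMod 2) else 0)) = 0 from by decide]
      generalize ε j = E0; generalize m3 j = Ma; generalize m1 j = Mb
      cases E0 <;> cases Ma <;> cases Mb <;> cases e3 <;> cases e1 <;> decide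
    · rw [hBsymm, q23, hav3, hav2, hm3, hm2, show ((if ((3 : Fin 4) = 0 ∧ (2 : Fin 4) = 1) ∨ ((3 : Fin 4) = 1 ∧ (2 : Fin 4) = 0) then (1 : ZMod 2) else 0) + (if ((3 : Fin 4) = 2 ∧ (2 : Fin 4) = 3) ∨ ((3 : Fin 4) = 3 ∧ (2 : Fin 4) = 2) then (1 : ZMod 2) else 0)) = 1 from by decide]
      generalize ε j = E0; generalize m3 j = Ma; generalize m2 j = Mb
      cases E0 <;> cases Ma <;> cases Mb <;> cases e3 <;> cases e2 <;> decide
    · rw [hBalt, hav3, hm3, show ((if ((3 : Fin 4) = 0 ∧ (3 : Fin 4) = 1) ∨ ((3 : Fin 4) = 1 ∧ (3 : Fin 4) = 0) then (1 : ZMod 2) else 0) + (if ((3 : Fin 4) = 2 ∧ (3 : Fin 4) = 3) ∨ ((3 : Fin 4) = 3 ∧ (3 : Fin 4) = 2) then (1 : ZMod 2) else 0)) = 0 from by decide, zero_mul, zero_add, h2]; simp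

end Summit.QuantumAdvantage.QuantumAdvantage.Theorems.CubicForrelation.NearExactIsExact
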